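import Literature.Probability.LatticeModels.BalabanStepOneFormatXYActivity

/-!
# Balaban's step-one format — calibration, part 2d: the XY Gibbs weight is in step-one format

**`xyWeight_stepOneFormat`.**  For every corridor rate `κ ≥ 0` and large-field rate `cL < 1/4` there is
`K₀` such that for all `K ≥ K₀`, on EVERY block torus `(ℤ/L')² × ℤ/M`, the nearest-neighbour XY Gibbs
weight `xyWeight K = exp (-K·misalign)` belongs to
`Literature.Probability.LatticeModels.BalabanStepOne.StepOneFormat K 14 1 cL κ L' M`
— the calibration of the format announced in `SPLIT-PROPOSAL.md` §4(a) of crux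
`BirGappedPhaseReductionR` (route BalabanIR of `HubbardSuperconductivity`): the class over which the
format ENGINE (`BirFormatEngine`) quantifies is inhabited, with these exact definitions, by the weight
whose slice order is the proved reflection-positivity instance of the engine's conclusion, and the
polymer identity below is the template of the MEMBERSHIP half for other weights.

Ingredients: `xyWeight_coerciveWeight` (W1–W4, part 1), `xyAction_quasiLocalAction` (W5a, part 2b),
`xyActivity_polymerActivity` (W5b, part 2c), and the REPRESENTATION IDENTITY `xyWeight_repr`
(every bond either avoids the large-field set — then it is a term of the small-field Gibbs exponent,
`sum_xyAction_disjoint` — or touches exactly one distance-`≤ 3` class of it — then it is a factor of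
exactly one activity of the canonical admissible family, to which the polymer gas collapses by
`sum_adm_prod_eq_prod_canon`; `sum_adm_xyActivity`), plus the threshold `eventually_xyThreshold`
(`η(K) = log K/√K → 0`, `log² K → ∞`, `1 - cos η ≥ η²/2 - (5/96) η⁴`).  Folklore.
-/

noncomputable section

open scoped BigOperators Classical
open Finset Filter MeasureTheory Complex

namespace Literature.Probability.LatticeModels.BalabanStepOne

variable {L' M : ℕ} [NeZero L'] [NeZero M]

omit [NeZero L'] [NeZero M] in
/-- The complex bond energy of a real configuration along a bond. [folklore] -/
theorem bondWeight_eq_cexp (K : ℝ) (θ : Site L' M → ℝ) (b : Site L' M × Fin 3) :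
    bondWeight K θ b = cexp (-((K : ℂ) * (1 - Complex.cos (grad (fun s => (θ s : ℂ)) b)))) := by
  simp only [bondWeight, grad, Complex.ofReal_exp, Complex.ofReal_neg, Complex.ofReal_mul,
    Complex.ofReal_sub, Complex.ofReal_one, Complex.ofReal_cos]

/-- The misalignment energy as the bond sum of the complex bond energies. [folklore] -/
theorem misalign_eq_sum_bonds (θ : Site L' M → ℝ) :
    (misalign θ : ℂ) = ∑ b : Site L' M × Fin 3, (1 - Complex.cos (grad (fun s => (θ s : ℂ)) b)) := by
  rw [Fintype.sum_prod_type]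
  simp only [misalign, grad, Complex.ofReal_sum, Complex.ofReal_sub, Complex.ofReal_one, Complex.ofReal_cos]

/-- The small-field Gibbs exponent: the bond actions over the site sets avoiding `Ω` add up to `K`
times the bond energies of the bonds NOT touching `Ω`. [folklore] -/
theorem sum_xyAction_disjoint (K : ℝ) (Ω : Finset (Site L' M)) (z : Site L' M → ℂ) :
    ∑ X ∈ univ.filter (fun X : Finset (Site L' M) => Disjoint X Ω), xyAction K X z =
      (K : ℂ) * ∑ b ∈ univ.filter (fun b : Site L' M × Fin 3 => ¬ Touch Ω b),
        (1 - Complex.cos (grad z b)) := by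
  unfold xyAction
  rw [← mul_sum]
  congr 1
  rw [sum_comm, sum_filter]
  refine sum_congr rfl fun b _ => ?_
  rw [sum_ite_eq' (univ.filter fun X : Finset (Site L' M) => Disjoint X Ω) (edge b)]
  simp only [mem_filter, mem_univ, true_and, touch_iff_not_disjoint, not_not, edge]

/-- The large-field polymer gas of the XY activities collapses to the product of the Gibbs factors of
the bonds touching the large-field set. [folklore] -/
theorem sum_adm_xyActivity (K : ℝ) (θ : Site L' M → ℝ) :
    ∑ Ps ∈ univ.filter (fun Ps : Finset (Finset (Site L' M)) => Adm (lfSet K θ) Ps),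
        ∏ P ∈ Ps, xyActivity K P θ =
      ∏ b ∈ univ.filter (fun b : Site L' M × Fin 3 => Touch (lfSet K θ) b), bondWeight K θ b := by
  rw [sum_adm_prod_eq_prod_canon (lfSet K θ) (fun P => xyActivity K P θ) fun P _ hbad =>
      xyActivityAux_eq_zero fun h => hbad ⟨h.1, h.2.1⟩,
    prod_canon_eq_prod_comps (lfSet K θ) fun P => xyActivity K P θ,
    prod_filter_touch_eq_prod_comps (lfSet K θ) (bondWeight K θ)]
  refine prod_congr rfl fun D hD => ?_
  obtain ⟨x, hx, rfl⟩ := mem_image.1 hD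
  obtain ⟨hconn, hint, hcl, hne⟩ := canon_spec hx
  unfold xyActivity xyActivityAux
  rw [if_pos ⟨hconn, hcl, hne⟩, hint]

/-- **The depth-one representation of the XY weight.** On every real configuration,
`exp (-K·misalign θ) = exp (-Σ_{X ∩ LF θ = ∅} A X θ) · Σ_{Ps ∈ Adm (LF θ)} Π_{P ∈ Ps} g P θ` with the
bond action `xyAction K` and the cluster activities `xyActivity K`. [folklore] -/
theorem xyWeight_repr (K : ℝ) (θ : Site L' M → ℝ) :
    xyWeight K θ =
      cexp (-(∑ X ∈ univ.filter (fun X : Finset (Site L' M) => Disjoint X (lfSet K θ)),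
              xyAction K X (fun s => (θ s : ℂ)))) *
        ∑ Ps ∈ univ.filter (fun Ps : Finset (Finset (Site L' M)) => Adm (lfSet K θ) Ps),
          ∏ P ∈ Ps, xyActivity K P θ := by
  rw [sum_adm_xyActivity, sum_xyAction_disjoint]
  simp only [bondWeight_eq_cexp]
  rw [← Complex.exp_sum, ← Complex.exp_add]
  unfold xyWeight
  rw [Complex.ofReal_exp]
  congr 1
  have h := sum_filter_add_sum_filter_not (univ : Finset (Site L' M × Fin 3))
    (fun b => ¬ Touch (lfSet K θ) b) (fun b => -((K : ℂ) * (1 - Complex.cos (grad (fun s => (θ s : ℂ)) b))))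
  simp only [not_not] at h
  have hL : ((-K * misalign θ : ℝ) : ℂ) =
      ∑ b : Site L' M × Fin 3, -((K : ℂ) * (1 - Complex.cos (grad (fun s => (θ s : ℂ)) b))) := by
    push_cast
    rw [misalign_eq_sum_bonds, Finset.mul_sum]
    exact sum_congr rfl fun b _ => by ring
  rw [hL, ← h]
  congr 1
  rw [Finset.mul_sum, ← Finset.sum_neg_distrib]

/-! #### The threshold `K₀(κ, cL)` -/

/-- For `cL < 1/4` the threshold conditions used by the calibration hold for all large `K`:
`K > 1`, `η(K) ≤ 1/5`, and `cL log² K + 6κ ≤ K (1 - cos η(K)) / 2`. [folklore] -/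
theorem eventually_xyThreshold (κ cL : ℝ) (hcL : cL < 1 / 4) :
    ∃ K₀ : ℝ, ∀ K : ℝ, K₀ ≤ K → 1 < K ∧ eta K ≤ 1 / 5 ∧ XYThreshold K cL κ := by
  set ε : ℝ := 1 / 4 - cL with hε
  have hεpos : 0 < ε := by rw [hε]; linarith
  -- log² K / K → 0
  have hlim : Tendsto (fun K : ℝ => Real.log K ^ 2 / K) atTop (nhds 0) := by
    have h := Real.tendsto_pow_log_div_mul_add_atTop 1 0 2 one_ne_zero
    simpa only [one_mul, add_zero] using h
  have hδ : 0 < min (1 / 25 : ℝ) (96 / 5 * ε) := lt_min (by norm_num) (by positivity)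
  have ev1 : ∀ᶠ K : ℝ in atTop, Real.log K ^ 2 / K < min (1 / 25 : ℝ) (96 / 5 * ε) :=
    (tendsto_order.1 hlim).2 _ hδ
  have ev2 : ∀ᶠ K : ℝ in atTop, 1 < K := eventually_gt_atTop 1
  -- log² K → ∞
  have ev3 : ∀ᶠ K : ℝ in atTop, 12 * |κ| / ε ≤ Real.log K ^ 2 := by
    have hlog2 : Tendsto (fun K : ℝ => Real.log K ^ 2) atTop atTop :=
      (tendsto_pow_atTop two_ne_zero).comp Real.tendsto_log_atTop
    exact hlog2.eventually_ge_atTop _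
  obtain ⟨K₀, hK₀⟩ := eventually_atTop.1 (ev1.and (ev2.and ev3))
  refine ⟨K₀, fun K hK => ?_⟩
  obtain ⟨h1, h2, h3⟩ := hK₀ K hK
  have hK0 : 0 < K := by linarith
  have hη2 : eta K ^ 2 = Real.log K ^ 2 / K := eta_sq hK0
  have hηpos : 0 < eta K := div_pos (Real.log_pos h2) (Real.sqrt_pos.2 hK0)
  have hη2le : eta K ^ 2 ≤ 1 / 25 := by rw [hη2]; exact (h1.le.trans (min_le_left _ _))
  have hη2le' : eta K ^ 2 ≤ 96 / 5 * ε := by rw [hη2]; exact (h1.le.trans (min_le_right _ _))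
  have hηle : eta K ≤ 1 / 5 := by nlinarith
  refine ⟨h2, hηle, ?_⟩
  -- the threshold inequality
  unfold XYThreshold pLF
  have hcos : 1 - Real.cos (eta K) ≥ eta K ^ 2 / 2 - eta K ^ 4 * (5 / 96) := by
    have hb := Real.cos_bound (show |eta K| ≤ 1 by rw [abs_of_pos hηpos]; nlinarith)
    have := (abs_le.1 hb).2
    rw [abs_of_pos hηpos] at this
    linarith
  have hlogK : Real.log K ^ 2 = K * eta K ^ 2 := by
    rw [hη2]; field_simp
  have hκ : κ ≤ |κ| := le_abs_self κ
  have h4 : eta K ^ 4 = (eta K ^ 2) ^ 2 := by ring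
  -- K (1 - cos η)/2 ≥ K η² (1/4 - (5/192) η²) ≥ K η² (1/4 - ε/2) and (ε/2) K η² ≥ 6 |κ|
  have hA : K * (1 - Real.cos (eta K)) / 2 ≥ K * eta K ^ 2 * (1 / 4 - ε / 2) := by
    have : K * (1 - Real.cos (eta K)) / 2 ≥ K * (eta K ^ 2 / 2 - eta K ^ 4 * (5 / 96)) / 2 := by
      have := mul_le_mul_of_nonneg_left hcos hK0.le
      linarith
    rw [h4] at this
    nlinarith [sq_nonneg (eta K ^ 2)]
  have hB : ε / 2 * (K * eta K ^ 2) ≥ 6 * |κ| := by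
    rw [← hlogK]
    have := (div_le_iff₀ hεpos).1 h3
    nlinarith
  calc cL * Real.log K ^ 2 + 6 * κ ≤ cL * Real.log K ^ 2 + 6 * |κ| := by linarith
    _ = (1 / 4 - ε) * (K * eta K ^ 2) + 6 * |κ| := by rw [hlogK, hε]; ring
    _ ≤ (1 / 4 - ε) * (K * eta K ^ 2) + ε / 2 * (K * eta K ^ 2) := by linarith
    _ = K * eta K ^ 2 * (1 / 4 - ε / 2) := by ring
    _ ≤ K * (1 - Real.cos (eta K)) / 2 := hA

/-! #### The membership theorem -/

/-- **Calibration of Balaban's step-one format by the XY model.** For every corridor rate `κ ≥ 0` and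
every large-field rate `cL < 1/4` there is a threshold `K₀` such that for all `K ≥ K₀`, on EVERY block
torus, the nearest-neighbour XY Gibbs weight `exp (-K·misalign)` is in
`StepOneFormat K 14 1 cL κ` — with the bond action `K(1 - cos ∂z)` as small-field action and the
cluster activities `xyActivity K` (products of the Gibbs factors of the bonds touching a distance-`≤ 3`
class of the large-field set, supported on the collars of the classes) as large-field activities.  In
particular the class over which the format engine quantifies is inhabited by the weight whose slice
order is the proved reflection-positivity instance of the engine's conclusion. [folklore] -/
theorem xyWeight_stepOneFormat {κ cL : ℝ} (hκ : 0 ≤ κ) (hcL : cL < 1 / 4) :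
    ∃ K₀ : ℝ, ∀ K : ℝ, K₀ ≤ K → ∀ (L' M : ℕ) [NeZero L'] [NeZero M],
      StepOneFormat K 14 1 cL κ L' M (xyWeight (L' := L') (M := M) K) := by
  obtain ⟨K₀, hK₀⟩ := eventually_xyThreshold κ cL hcL
  refine ⟨K₀, fun K hK L' M _ _ => ?_⟩
  obtain ⟨h1, hη, hth⟩ := hK₀ K hK
  exact ⟨xyWeight_coerciveWeight K, xyAction K, xyActivity K, xyAction_quasiLocalAction h1 hη hκ,
    xyActivity_polymerActivity (by linarith) hκ hth, xyWeight_repr K⟩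

end Literature.Probability.LatticeModels.BalabanStepOne

end
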